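import Literature.MathematicalPhysics.QuantumFieldTheory.Balaban1983to89.B13Term214Centred

/-!
# `Balaban1983to89.B13CentredExpLetters` — T. Bałaban, *Renormalization group approach to lattice gauge field theories. II.
Cluster expansions*, Commun. Math. Phys. **116** (1988) 1–22 [Balaban1988RG2Cluster], pp. 15–16, with [Balaban1987RG1]
(2.9)–(2.13) pp. 266–268: the TAYLOR LETTERS of the CENTRED chain (`B13Term214Centred` ∕ `B13Bound226Centred`) in the
EXPONENTIAL-MOMENT currency — `Σ|τ||𝐕 − 𝐕₀| ≤ s·K₁e^{½a₁ B·B}`, `Σ|τ||𝐕 − 𝐕₀ − 𝐕₁| ≤ s²·K₂e^{½a₂ B·B}` plus ONE `s`-free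
quadratic letter — which give the SAME Gaussian-shaped majorant of the centred printed last line as the linear-Gaussian
letters of `B13Term214Centred.norm_F214_centred_le_gauss` (`norm_F214_centred_le_gaussExp`, `sum_norm_V₁_le_exp`), the reason
they are needed (`linLetter_fails_cubic`: a CUBIC first-order term — the three-gluon vertex of [I] (2.10)–(2.12) — meets no
linear-Gaussian letter uniformly on the small-field box `s|B| < ε₁`), and the elementary fact that the UNSCALED-FIELD law
`𝐕_s(B) = s⁻²𝒲(sB) + 𝒪(sB)` of [I] p. 267 («B = g_kB′») meets the exponential letters with `s`-FREE constants under homogeneous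
global majorants of the coupling-free functions

statement-level skeleton of published theorems with citation tags; proofs where landed; nothing here is a claim about the
Yang–Mills mass gap

PDF held: `paper:balaban1988-cmp116-rg-ii-cluster` (journal page = PDF page + 0), pp. 15–16 (quoted in full in `B13Term214`,
`B13FirstEstimate215`, `B13Integral223`); `paper:balaban1987-cmp109-rg-i` pp. 266–268 (render
`b2b-balaban-ref1/pages/1987-cmp109-rg-I-small-field/…-p018∕p019∕p020-x2.png`).

CITATION HEADER.  [II] p. 16 (2.20): *"Σ_Y |τ(Y)| |𝐕(Y, …)| ≤ ½a₂₀⟨B,B⟩ + …"* (shape; quoted in `B13Integral223`); p. 6 (1.20)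
«… and g_k|B| < ε₁»; [I] p. 266 (2.9) *"χ_k = Π_b χ({|B′(b)| < ε₁})"* (the box BEFORE the scaling), p. 267 after (2.12): *"Next we
make the scaling transformation B = g_kB′ … Hence the only term with a negative power of g_k is the action evaluated at U_{k+1}.
Terms of the order 0 in g_k are (2.11)"*, p. 268 after (2.13): *"Let us remark that the expression under the exponential above
vanishes at g_k = 0"*.  NOT PRINTED: any Taylor letter of a CENTRED term (print never centres; (2.20) is `s`-free); what is
recorded is which letter SHAPE the printed law `s⁻²𝒲(s·) + 𝒪(s·)` (with `𝒲` of third order) can meet uniformly in `s`.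

PROVENANCE.  §1–§4 are a PORT WITH PROVENANCE of the memo-only lens seat's sketch
`run/shared/lean/pub/pub-ymgap/ym-lens-BalabanUVNodes-transfer/lean/LensTransferSketch14.lean` (sha16 28436c86aad75fd4, namespace
`YMLens.Transfer14`, seat `ym-lens-BalabanUVNodes-transfer` g14, Card T26 ∕ ERRATUM E6 + rider P⁶ of `LENS-transfer.md` §20; bus
`run/shared/lean/pub/pub-ymgap/INBOX.md` l.19382: *«a located ERRATUM on ★42B's HYPOTHESIS SHAPE — my own Sketch12 §C design —
with the typed repair, take or leave … Port with or without credit; the lens files nothing»*): statements and proofs are the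
lens's, re-homed under `Literature` so that tree files can import them (decl blocks identical modulo namespace, header,
docstrings and `private` on three arithmetic helpers), each docstring saying so.  Cell `pub-ymgap`, seat `pub-ymgap-dag-n10-c`
(g7), node N10 [B13]; consumer: this seat's `B13Bound226CentredRem` (the remainder-letter twin of `B13Bound226Centred` §2∕§3 and
its exponential-letter corollaries), hence node N22's (S-vertex-T′) (`Summits/…/BalabanUVNodesN22W1RelCentredSectorOfWindowDilated`
J1 `centred_of_twoStep`, whose `M₁` must be uniform in the coupling); the datum side (the growth schema as FIELDS of the W1 datum)
is the definer's ∕ the unseated N09 successor's.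

WHAT IS HERE (no definition).
* §1 THE HONESTY THEOREM `linLetter_fails_cubic` (lens kill-test k18): for every `(a, w)`, box constant `ε` and cubic size `c`
  there are `s > 0` and `x ≥ 0` inside the box (`s·x < ε`) with `s(½a x² + w) < c·s·x³` — the linear-Gaussian first-order letter
  `h1U` of `B13Bound226Centred` has no `s`-uniform inhabitant whose first-order term is cubic (same for `h2U`, quartic).
* §2 POLYNOMIAL MOMENTS ARE GAUSSIAN-DOMINATED: `pi_norm_sq_le_dotProduct` (`‖B‖² ≤ B·B`, sup norm), `norm_pow_le_gauss`
  (`‖B‖^k ≤ (k/(eδ))^k e^{δ/2}·e^{½δ B·B}`, any `δ > 0`).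
* §3 THE CENTRED PRINTED LAST LINE UNDER EXPONENTIAL-MOMENT LETTERS: `expLetter_of_linLetter` (old letters ⇒ new),
  `h1q_of_h220` (the `s`-free quadratic letter is free from (2.20) + the centre's `w₀`), `sum_norm_V₁_le_exp` (twin of
  `B13Bound226Centred.sum_norm_V₁_le`), `norm_F214_centred_le_gaussExp` (twin of `B13Term214Centred.norm_F214_centred_le_gauss`,
  constant `e^{w₀}(K₂ + K₁²e^{w_q})`, rates `a₂ ≤ a_c`, `2a₁ + a_q ≤ a_c`) — SAME output shapes, built on the letter-free
  `B13Term214Centred.norm_F214_centred_le`.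
* §4 THE UNSCALED-FIELD LAW MEETS THEM, `s`-FREE constants, arbitrary rate: `norm_scaledW_le`, `firstOrder_unscaled`,
  `secondOrder_unscaled` (odd part `𝐕₁ = s(𝒲₃ + D𝒪)`), `odd_of_homogeneous`, `h220_unscaled_onBox` ((2.20)'s small rate is a
  BOX fact), `firstOrder_unscaled_gauss`, `secondOrder_unscaled_gauss`, `h1e_of_unscaledLaw`, `h2e_of_unscaledLaw` — for
  GENERIC functions `𝒲 𝒲₃ 𝒪 D𝒪 : (Λ → ℝ) → ℂ` under six homogeneous global majorants (no W1 object is read).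
HONEST SCOPE.  Elementary (Taylor's `|eˣ − 1 − y| ≤ |x − y| + |x|²e^{|x|}` inside the cited lemma; `x^k ≤ (k/(eb))^k e^{bx}`);
no estimate new in kind.  The homogeneous majorants `c₃, c₄, c₁, c₂`, the cubic part `𝒲₃` and the differential `D𝒪` are
the PRODUCER's data about the datum ([I] (2.10)–(2.12)) — hypotheses here.  Nothing of Bałaban's kernels or potentials is
constructed; N10∕N22∕N09 NOT discharged.  No `sorry`, no definition, no new named fact (D-0026).
-/

noncomputable section

namespace Literature.MathematicalPhysics.QuantumFieldTheory.Balaban1983to89.B13CentredExpLetters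

open Matrix MeasureTheory Finset Complex Metric Set
open scoped Real
open B13Term214 (F214)
open B13Term214Centred (norm_F214_centred_le)

variable {Λ : Type} [Fintype Λ]
variable {D : Type*}

/-! ## §1. The honesty theorem: a linear-Gaussian first-order letter cannot hold for a cubic first-order term on the box,
uniformly in `s` (lens Sketch14 §K, kill-test k18) -/

omit [Fintype Λ] in
/-- **WHY THE EXPONENTIAL LETTERS** (lens Sketch14 `linLetter_fails_cubic`, kill-test k18).  For every `(a, w)` with
`a, w ≥ 0` and every box constant `ε > 0`, cubic size `c > 0`: there are a coupling `s > 0` and a field size `x ≥ 0` INSIDE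
the small-field box (`s·x < ε`) at which `s(½a x² + w) < c·s·x³` — i.e. the linear-Gaussian Taylor letter
`s·c‖B‖³ ≤ s(½a‖B‖² + w)` asked by `B13Bound226Centred.norm_core214_sub_le_K_centred_of_primitives` (`h1`) is violated by any
family whose first-order term is cubic in the field (the three-gluon term of [I] (2.10)–(2.12), read in the unscaled field
`B = g_kB′` on the box `g_k|B| < ε₁` of [II] (1.20)). [cite: Balaban1987RG1, (2.10)–(2.12) p.267; Balaban1988RG2Cluster, (1.20) p.6, (2.20) p.16] (elementary arithmetic about the letter shapes) -/
theorem linLetter_fails_cubic {a w ε c : ℝ} (ha : 0 ≤ a) (hw : 0 ≤ w) (hε : 0 < ε) (hc : 0 < c) :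
    ∃ s x : ℝ, 0 < s ∧ 0 ≤ x ∧ s * x < ε ∧ s * (a / 2 * x ^ 2 + w) < c * s * x ^ 3 := by
  set x : ℝ := 1 + (a / 2 + w + 1) / c with hx
  have hcx : c * x = c + (a / 2 + w + 1) := by rw [hx, mul_add, mul_one, mul_div_cancel₀ _ hc.ne']
  have hx1 : 1 ≤ x := by
    have h : 0 ≤ (a / 2 + w + 1) / c := by positivity
    rw [hx]; linarith
  have hx0 : 0 < x := by linarith
  have hx2 : 1 ≤ x ^ 2 := by nlinarith
  have key : a / 2 * x ^ 2 + w < c * x ^ 3 := by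
    have h1 : (a / 2 + w + 1) * x ^ 2 ≤ c * x * x ^ 2 :=
      mul_le_mul_of_nonneg_right (by rw [hcx]; linarith) (sq_nonneg x)
    have h2 : w + 1 ≤ (w + 1) * x ^ 2 := le_mul_of_one_le_right (by linarith) hx2
    nlinarith
  refine ⟨ε / (2 * x), x, by positivity, hx0.le, ?_, ?_⟩
  · have e : ε / (2 * x) * x = ε / 2 := by field_simp
    rw [e]; linarith
  · have hs : 0 < ε / (2 * x) := by positivity
    calc ε / (2 * x) * (a / 2 * x ^ 2 + w) < ε / (2 * x) * (c * x ^ 3) := mul_lt_mul_of_pos_left key hs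
      _ = c * (ε / (2 * x)) * x ^ 3 := by ring

/-! ## §2. Polynomial moments are Gaussian-dominated (lens Sketch14 §D) -/

omit [Fintype Λ] in
/-- `x^k ≤ (k/(e·b))^k · e^{bx}` for `x ≥ 0`, `b > 0`, `k ≥ 1` (from `t ≤ e^{t−1}` at `t = bx/k`; lens Sketch14
`pow_le_const_mul_exp`). [folklore] -/
private theorem pow_le_const_mul_exp {x b : ℝ} (hx : 0 ≤ x) (hb : 0 < b) {k : ℕ} (hk : 1 ≤ k) :
    x ^ k ≤ ((k : ℝ) / (Real.exp 1 * b)) ^ k * Real.exp (b * x) := by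
  have hk0 : (0 : ℝ) < k := by exact_mod_cast hk
  set t : ℝ := b * x / k with ht
  have ht0 : 0 ≤ t := by positivity
  have h1 : t ≤ Real.exp (t - 1) := by linarith [Real.add_one_le_exp (t - 1)]
  have h2 : t ^ k ≤ Real.exp (b * x) / Real.exp k := by
    have h := pow_le_pow_left₀ ht0 h1 k
    have e : Real.exp (t - 1) ^ k = Real.exp (b * x) / Real.exp k := by
      rw [← Real.exp_nat_mul, ← Real.exp_sub]
      congr 1
      rw [ht]; field_simp
    rwa [e] at h
  have h3 : x ^ k = ((k : ℝ) / b) ^ k * t ^ k := by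
    rw [← mul_pow]; congr 1; rw [ht]; field_simp
  rw [h3]
  calc ((k : ℝ) / b) ^ k * t ^ k ≤ ((k : ℝ) / b) ^ k * (Real.exp (b * x) / Real.exp k) :=
        mul_le_mul_of_nonneg_left h2 (by positivity)
    _ = ((k : ℝ) / (Real.exp 1 * b)) ^ k * Real.exp (b * x) := by
        rw [← Real.exp_one_pow k, div_pow, div_pow, mul_pow]
        field_simp

/-- `‖B‖² ≤ B·B` for the sup norm of a real field on a finite index set (lens Sketch14 `pi_norm_sq_le_dotProduct`): the
bridge between the sup-norm box∕majorants of [I] (2.9)–(2.12) and the quadratic form `⟨B,B⟩` of (2.20)∕(2.22).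
[cite: Balaban1988RG2Cluster, (2.20) p.16, (2.22) p.16] (elementary API for the (2.20)-type letters) -/
theorem pi_norm_sq_le_dotProduct (B : Λ → ℝ) : ‖B‖ ^ 2 ≤ B ⬝ᵥ B := by
  have hBB : 0 ≤ B ⬝ᵥ B := Finset.sum_nonneg fun i _ => mul_self_nonneg (B i)
  have h : ‖B‖ ≤ Real.sqrt (B ⬝ᵥ B) := by
    refine (pi_norm_le_iff_of_nonneg (Real.sqrt_nonneg _)).2 fun i => ?_
    rw [Real.norm_eq_abs, ← Real.sqrt_sq_eq_abs]
    refine Real.sqrt_le_sqrt ?_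
    rw [sq]
    exact Finset.single_le_sum (f := fun j => B j * B j) (fun j _ => mul_self_nonneg (B j)) (Finset.mem_univ i)
  calc ‖B‖ ^ 2 ≤ Real.sqrt (B ⬝ᵥ B) ^ 2 := pow_le_pow_left₀ (norm_nonneg _) h 2
    _ = B ⬝ᵥ B := Real.sq_sqrt hBB

/-- `e^{δ‖B‖} ≤ e^{δ/2}·e^{½δ B·B}` (`2‖B‖ ≤ 1 + ‖B‖² ≤ 1 + B·B`; lens Sketch14 `exp_mul_norm_le_gauss`). [folklore] -/
private theorem exp_mul_norm_le_gauss (B : Λ → ℝ) {δ : ℝ} (hδ : 0 ≤ δ) :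
    Real.exp (δ * ‖B‖) ≤ Real.exp (δ / 2) * Real.exp (δ / 2 * (B ⬝ᵥ B)) := by
  rw [← Real.exp_add]
  refine Real.exp_le_exp.2 ?_
  have h1 : 2 * ‖B‖ ≤ 1 + ‖B‖ ^ 2 := by nlinarith [sq_nonneg (‖B‖ - 1)]
  have h2 := pi_norm_sq_le_dotProduct B
  nlinarith [mul_le_mul_of_nonneg_left h1 hδ, mul_le_mul_of_nonneg_left h2 hδ]

/-- **Polynomial moments are Gaussian-dominated** (lens Sketch14 `norm_pow_le_gauss`):
`‖B‖^k ≤ (k/(eδ))^k e^{δ/2} · e^{½δ B·B}` for any rate `δ > 0`, `k ≥ 1`.  This is what turns HOMOGENEOUS majorants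
(`s·c‖B‖³`, `s²·c‖B‖⁴`) into exponential-moment Taylor letters with an arbitrarily small Gaussian rate and `s`-free constants.
[cite: Balaban1988RG2Cluster, (2.20) p.16; Balaban1987RG1, (2.10)–(2.12) p.267] (elementary API for the (2.20)-type letters) -/
theorem norm_pow_le_gauss (B : Λ → ℝ) {δ : ℝ} (hδ : 0 < δ) {k : ℕ} (hk : 1 ≤ k) :
    ‖B‖ ^ k ≤ ((k : ℝ) / (Real.exp 1 * δ)) ^ k * Real.exp (δ / 2) * Real.exp (δ / 2 * (B ⬝ᵥ B)) := by
  calc ‖B‖ ^ k ≤ ((k : ℝ) / (Real.exp 1 * δ)) ^ k * Real.exp (δ * ‖B‖) := pow_le_const_mul_exp (norm_nonneg _) hδ hk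
    _ ≤ ((k : ℝ) / (Real.exp 1 * δ)) ^ k * (Real.exp (δ / 2) * Real.exp (δ / 2 * (B ⬝ᵥ B))) :=
        mul_le_mul_of_nonneg_left (exp_mul_norm_le_gauss B hδ.le) (by positivity)
    _ = _ := by ring

/-! ## §3. The centred printed last line under EXPONENTIAL-MOMENT Taylor letters — same Gaussian-shaped majorants as the
linear-Gaussian road (lens Sketch14 §C) -/

omit [Fintype Λ] in
/-- `½a q + w ≤ e^w · e^{½a q}` (`y ≤ e^y`; lens Sketch14 `linGauss_le_expGauss`): the linear-Gaussian currency is dominated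
by the exponential one. [folklore] -/
private theorem linGauss_le_expGauss (a q w : ℝ) : a / 2 * q + w ≤ Real.exp w * Real.exp (a / 2 * q) := by
  rw [← Real.exp_add]; linarith [Real.add_one_le_exp (w + a / 2 * q)]

omit [Fintype Λ] in
/-- **The old letters imply the new** (lens Sketch14 `expLetter_of_linLetter`): `T ≤ c(½a q + w)` ⇒ `T ≤ c·(e^w·e^{½a q})`
for `c ≥ 0` (`c = s` or `s²`) — the linear-Gaussian Taylor letters `h1∕h2` of `B13Bound226Centred` imply the exponential ones
with `K₁ = e^{w₁}`, `K₂ = e^{w₂}`. [cite: Balaban1988RG2Cluster, (2.20) p.16] (elementary API for the (2.20)-type letters) -/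
theorem expLetter_of_linLetter {T c a q w : ℝ} (hc : 0 ≤ c) (h : T ≤ c * (a / 2 * q + w)) :
    T ≤ c * (Real.exp w * Real.exp (a / 2 * q)) :=
  h.trans (mul_le_mul_of_nonneg_left (linGauss_le_expGauss a q w) hc)

/-- **The `s`-free quadratic first-order letter is FREE** (lens Sketch14 `h1q_of_h220`):
`Σ|τ||𝐕 − 𝐕₀| ≤ ½a₂₀ B·B + (w + w₀)` from (2.20) for `𝐕` and the centre's letter `Σ|τ||𝐕₀| ≤ w₀` — both already hypotheses of
`B13Bound226Centred.norm_core214_sub_le_K_centred_of_primitives`. [cite: Balaban1988RG2Cluster, (2.20) p.16] (elementary API for (2.20)) -/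
theorem h1q_of_h220 (Dfam : Finset D) (τ : D → ℂ) {V V₀ : D → (Λ → ℝ) → ℂ} (B : Λ → ℝ) {a₂₀ w w₀ : ℝ}
    (h220 : ∑ Y ∈ Dfam, ‖τ Y‖ * ‖V Y B‖ ≤ a₂₀ / 2 * (B ⬝ᵥ B) + w)
    (hw₀ : ∑ Y ∈ Dfam, ‖τ Y‖ * ‖V₀ Y B‖ ≤ w₀) :
    ∑ Y ∈ Dfam, ‖τ Y‖ * ‖V Y B - V₀ Y B‖ ≤ a₂₀ / 2 * (B ⬝ᵥ B) + (w + w₀) := by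
  have h : ∑ Y ∈ Dfam, ‖τ Y‖ * ‖V Y B - V₀ Y B‖
      ≤ ∑ Y ∈ Dfam, ‖τ Y‖ * ‖V Y B‖ + ∑ Y ∈ Dfam, ‖τ Y‖ * ‖V₀ Y B‖ := by
    rw [← Finset.sum_add_distrib]
    refine Finset.sum_le_sum fun Y _ => ?_
    rw [← mul_add]
    exact mul_le_mul_of_nonneg_left (norm_sub_le _ _) (norm_nonneg _)
  linarith

/-- **The odd part's Gaussian bound from EXPONENTIAL letters** (lens Sketch14 `sum_norm_V₁_le_exp`; twin of
`B13Bound226Centred.sum_norm_V₁_le`, same output shape): `Σ|τ||𝐕₁| ≤ (sK₁ + s²K₂)·e^{½a_c B·B}` (triangle inequality between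
the two Taylor letters, rates raised to `a_c`). [cite: Balaban1988RG2Cluster, (2.20) p.16] (elementary API for (2.20)) -/
theorem sum_norm_V₁_le_exp (Dfam : Finset D) (τ : D → ℂ) {V V₀ V₁ : D → (Λ → ℝ) → ℂ} (B : Λ → ℝ)
    {s K₁ a₁ K₂ a₂ ac : ℝ} (hs : 0 ≤ s) (hK₁ : 0 ≤ K₁) (hK₂ : 0 ≤ K₂) (ha₁ : a₁ ≤ ac) (ha₂ : a₂ ≤ ac)
    (h1e : ∑ Y ∈ Dfam, ‖τ Y‖ * ‖V Y B - V₀ Y B‖ ≤ s * (K₁ * Real.exp (a₁ / 2 * (B ⬝ᵥ B))))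
    (h2e : ∑ Y ∈ Dfam, ‖τ Y‖ * ‖V Y B - V₀ Y B - V₁ Y B‖ ≤ s ^ 2 * (K₂ * Real.exp (a₂ / 2 * (B ⬝ᵥ B)))) :
    ∑ Y ∈ Dfam, ‖τ Y‖ * ‖V₁ Y B‖ ≤ (s * K₁ + s ^ 2 * K₂) * Real.exp (ac / 2 * (B ⬝ᵥ B)) := by
  have hBB : 0 ≤ B ⬝ᵥ B := Finset.sum_nonneg fun i _ => mul_self_nonneg (B i)
  have htri : ∑ Y ∈ Dfam, ‖τ Y‖ * ‖V₁ Y B‖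
      ≤ ∑ Y ∈ Dfam, ‖τ Y‖ * ‖V Y B - V₀ Y B‖ + ∑ Y ∈ Dfam, ‖τ Y‖ * ‖V Y B - V₀ Y B - V₁ Y B‖ := by
    rw [← Finset.sum_add_distrib]
    refine Finset.sum_le_sum fun Y _ => ?_
    rw [← mul_add]
    refine mul_le_mul_of_nonneg_left ?_ (norm_nonneg _)
    have e : V₁ Y B = (V Y B - V₀ Y B) - (V Y B - V₀ Y B - V₁ Y B) := by ring
    calc ‖V₁ Y B‖ = ‖(V Y B - V₀ Y B) - (V Y B - V₀ Y B - V₁ Y B)‖ := by rw [← e]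
      _ ≤ _ := norm_sub_le _ _
  have e1 : Real.exp (a₁ / 2 * (B ⬝ᵥ B)) ≤ Real.exp (ac / 2 * (B ⬝ᵥ B)) :=
    Real.exp_le_exp.2 (mul_le_mul_of_nonneg_right (by linarith) hBB)
  have e2 : Real.exp (a₂ / 2 * (B ⬝ᵥ B)) ≤ Real.exp (ac / 2 * (B ⬝ᵥ B)) :=
    Real.exp_le_exp.2 (mul_le_mul_of_nonneg_right (by linarith) hBB)
  calc ∑ Y ∈ Dfam, ‖τ Y‖ * ‖V₁ Y B‖
      ≤ s * (K₁ * Real.exp (a₁ / 2 * (B ⬝ᵥ B))) + s ^ 2 * (K₂ * Real.exp (a₂ / 2 * (B ⬝ᵥ B))) :=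
        htri.trans (add_le_add h1e h2e)
    _ ≤ s * (K₁ * Real.exp (ac / 2 * (B ⬝ᵥ B))) + s ^ 2 * (K₂ * Real.exp (ac / 2 * (B ⬝ᵥ B))) :=
        add_le_add (mul_le_mul_of_nonneg_left (mul_le_mul_of_nonneg_left e1 hK₁) hs)
          (mul_le_mul_of_nonneg_left (mul_le_mul_of_nonneg_left e2 hK₂) (sq_nonneg s))
    _ = (s * K₁ + s ^ 2 * K₂) * Real.exp (ac / 2 * (B ⬝ᵥ B)) := by ring

/-- **THE CENTRED PRINTED LAST LINE UNDER EXPONENTIAL-MOMENT TAYLOR LETTERS** (lens Sketch14 `norm_F214_centred_le_gaussExp`;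
the repair of lens Sketch12's ∕ `B13Term214Centred.norm_F214_centred_le_gauss`, same output shape): with the centre's letter
`Σ|τ||𝐕₀| ≤ w₀`, ONE `s`-free quadratic letter `Σ|τ||𝐕 − 𝐕₀| ≤ ½a_q B·B + w_q` (free from (2.20): `h1q_of_h220`), and the
exponential Taylor letters `Σ|τ||𝐕 − 𝐕₀| ≤ s·K₁e^{½a₁ B·B}`, `Σ|τ||𝐕 − 𝐕₀ − 𝐕₁| ≤ s²·K₂e^{½a₂ B·B}`, rates `a₂ ≤ a_c`,
`2a₁ + a_q ≤ a_c`: `‖F214(𝐕) − F214(𝐕₀) − F214(𝐕₀)Στ𝐕₁‖ ≤ s²·χχᶜ·e^{w₀}(K₂ + K₁²e^{w_q})·e^{½a_c B·B}` — the letter-free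
`B13Term214Centred.norm_F214_centred_le` (`|eˣ − 1 − y| ≤ |x − y| + |x|²e^{|x|}`) with `e^{|x|}` fed by the quadratic letter and
the `s²` by the exponential ones.  These letters ARE met by the unscaled-field law with `s`-free constants (§4); the
linear-Gaussian ones are not (§1). [cite: Balaban1988RG2Cluster, (2.14)–(2.15) p.15, (2.20) p.16; Balaban1987RG1, (2.13) p.268] -/
theorem norm_F214_centred_le_gaussExp (cardP : ℕ) (χY₀ χcP : (Λ → ℝ) → ℝ) (Dfam : Finset D)
    (V V₀ V₁ : D → (Λ → ℝ) → ℂ) (τ : D → ℂ) (B : Λ → ℝ) (hχ0 : 0 ≤ χY₀ B) (hχc0 : 0 ≤ χcP B)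
    {s aq wq w₀ K₁ a₁ K₂ a₂ ac : ℝ} (hK₂ : 0 ≤ K₂) (hac₂ : a₂ ≤ ac) (hac₁ : 2 * a₁ + aq ≤ ac)
    (hw₀ : ∑ Y ∈ Dfam, ‖τ Y‖ * ‖V₀ Y B‖ ≤ w₀)
    (h1q : ∑ Y ∈ Dfam, ‖τ Y‖ * ‖V Y B - V₀ Y B‖ ≤ aq / 2 * (B ⬝ᵥ B) + wq)
    (h1e : ∑ Y ∈ Dfam, ‖τ Y‖ * ‖V Y B - V₀ Y B‖ ≤ s * (K₁ * Real.exp (a₁ / 2 * (B ⬝ᵥ B))))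
    (h2e : ∑ Y ∈ Dfam, ‖τ Y‖ * ‖V Y B - V₀ Y B - V₁ Y B‖ ≤ s ^ 2 * (K₂ * Real.exp (a₂ / 2 * (B ⬝ᵥ B)))) :
    ‖F214 cardP χY₀ χcP Dfam V τ B - F214 cardP χY₀ χcP Dfam V₀ τ B
        - F214 cardP χY₀ χcP Dfam V₀ τ B * ∑ Y ∈ Dfam, τ Y * V₁ Y B‖
      ≤ s ^ 2 * (χY₀ B * χcP B * (Real.exp w₀ * (K₂ + K₁ ^ 2 * Real.exp wq)
          * Real.exp (ac / 2 * (B ⬝ᵥ B)))) := by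
  refine (norm_F214_centred_le cardP χY₀ χcP Dfam V V₀ V₁ τ B hχ0 hχc0).trans ?_
  have hBB : 0 ≤ B ⬝ᵥ B := Finset.sum_nonneg fun i _ => mul_self_nonneg (B i)
  set T₁ : ℝ := ∑ Y ∈ Dfam, ‖τ Y‖ * ‖V Y B - V₀ Y B‖ with hT₁
  set T₂ : ℝ := ∑ Y ∈ Dfam, ‖τ Y‖ * ‖V Y B - V₀ Y B - V₁ Y B‖ with hT₂
  have hT₁0 : 0 ≤ T₁ := Finset.sum_nonneg fun Y _ => mul_nonneg (norm_nonneg _) (norm_nonneg _)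
  have hT₂0 : 0 ≤ T₂ := Finset.sum_nonneg fun Y _ => mul_nonneg (norm_nonneg _) (norm_nonneg _)
  have hexpT₁ : Real.exp T₁ ≤ Real.exp wq * Real.exp (aq / 2 * (B ⬝ᵥ B)) := by
    rw [← Real.exp_add]; exact Real.exp_le_exp.2 (by linarith)
  have hT₁sq : T₁ ^ 2 ≤ s ^ 2 * (K₁ ^ 2 * Real.exp (a₁ * (B ⬝ᵥ B))) := by
    have h := pow_le_pow_left₀ hT₁0 h1e 2
    have e2 : Real.exp (a₁ / 2 * (B ⬝ᵥ B)) ^ 2 = Real.exp (a₁ * (B ⬝ᵥ B)) := by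
      rw [sq, ← Real.exp_add]; congr 1; ring
    have e : (s * (K₁ * Real.exp (a₁ / 2 * (B ⬝ᵥ B)))) ^ 2 = s ^ 2 * (K₁ ^ 2 * Real.exp (a₁ * (B ⬝ᵥ B))) := by
      rw [mul_pow, mul_pow, e2]
    rwa [e] at h
  have hterm1 : T₁ ^ 2 * Real.exp T₁ ≤ s ^ 2 * (K₁ ^ 2 * Real.exp wq) * Real.exp (ac / 2 * (B ⬝ᵥ B)) := by
    calc T₁ ^ 2 * Real.exp T₁
        ≤ (s ^ 2 * (K₁ ^ 2 * Real.exp (a₁ * (B ⬝ᵥ B)))) * (Real.exp wq * Real.exp (aq / 2 * (B ⬝ᵥ B))) :=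
          mul_le_mul hT₁sq hexpT₁ (Real.exp_pos _).le (by positivity)
      _ = s ^ 2 * (K₁ ^ 2 * Real.exp wq) * Real.exp ((2 * a₁ + aq) / 2 * (B ⬝ᵥ B)) := by
          have e : Real.exp ((2 * a₁ + aq) / 2 * (B ⬝ᵥ B))
              = Real.exp (a₁ * (B ⬝ᵥ B)) * Real.exp (aq / 2 * (B ⬝ᵥ B)) := by
            rw [← Real.exp_add]; congr 1; ring
          rw [e]; ring
      _ ≤ s ^ 2 * (K₁ ^ 2 * Real.exp wq) * Real.exp (ac / 2 * (B ⬝ᵥ B)) :=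
          mul_le_mul_of_nonneg_left (Real.exp_le_exp.2 (mul_le_mul_of_nonneg_right (by linarith) hBB))
            (by positivity)
  have hterm2 : T₂ ≤ s ^ 2 * K₂ * Real.exp (ac / 2 * (B ⬝ᵥ B)) := by
    calc T₂ ≤ s ^ 2 * (K₂ * Real.exp (a₂ / 2 * (B ⬝ᵥ B))) := h2e
      _ ≤ s ^ 2 * (K₂ * Real.exp (ac / 2 * (B ⬝ᵥ B))) :=
          mul_le_mul_of_nonneg_left
            (mul_le_mul_of_nonneg_left (Real.exp_le_exp.2 (mul_le_mul_of_nonneg_right (by linarith) hBB)) hK₂)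
            (sq_nonneg _)
      _ = _ := by ring
  have hw0e : Real.exp (∑ Y ∈ Dfam, ‖τ Y‖ * ‖V₀ Y B‖) ≤ Real.exp w₀ := Real.exp_le_exp.2 hw₀
  calc χY₀ B * χcP B * Real.exp (∑ Y ∈ Dfam, ‖τ Y‖ * ‖V₀ Y B‖) * (T₂ + T₁ ^ 2 * Real.exp T₁)
      ≤ χY₀ B * χcP B * Real.exp w₀
          * (s ^ 2 * K₂ * Real.exp (ac / 2 * (B ⬝ᵥ B))
             + s ^ 2 * (K₁ ^ 2 * Real.exp wq) * Real.exp (ac / 2 * (B ⬝ᵥ B))) :=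
        mul_le_mul (mul_le_mul_of_nonneg_left hw0e (mul_nonneg hχ0 hχc0)) (add_le_add hterm2 hterm1)
          (add_nonneg hT₂0 (mul_nonneg (sq_nonneg _) (Real.exp_pos _).le)) (by positivity)
    _ = s ^ 2 * (χY₀ B * χcP B * (Real.exp w₀ * (K₂ + K₁ ^ 2 * Real.exp wq)
          * Real.exp (ac / 2 * (B ⬝ᵥ B)))) := by ring

/-! ## §4. The UNSCALED-FIELD LAW meets the exponential letters with `s`-FREE constants (lens Sketch14 §U) -/

/-- `‖s⁻²𝒲(sB)‖ ≤ s·c₃‖B‖³` from the homogeneous cubic majorant `‖𝒲(A)‖ ≤ c₃‖A‖³` (the Wilson remainder of [I] (2.10)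
«× g_k⁻²», read in the unscaled field `B = g_kB′`; lens Sketch14 `norm_scaledW_le`). [cite: Balaban1987RG1, (2.10)–(2.12) p.267] -/
theorem norm_scaledW_le {𝒲 : (Λ → ℝ) → ℂ} {c₃ s : ℝ} (hs : 0 < s) (h𝒲 : ∀ A, ‖𝒲 A‖ ≤ c₃ * ‖A‖ ^ 3)
    (B : Λ → ℝ) : ‖((s : ℂ) ^ 2)⁻¹ * 𝒲 (s • B)‖ ≤ s * (c₃ * ‖B‖ ^ 3) := by
  have hsB : ‖s • B‖ = s * ‖B‖ := by rw [norm_smul, Real.norm_eq_abs, abs_of_pos hs]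
  rw [norm_mul, norm_inv, norm_pow, Complex.norm_real, Real.norm_eq_abs, abs_of_pos hs]
  calc (s ^ 2)⁻¹ * ‖𝒲 (s • B)‖ ≤ (s ^ 2)⁻¹ * (c₃ * ‖s • B‖ ^ 3) :=
        mul_le_mul_of_nonneg_left (h𝒲 _) (by positivity)
    _ = s * (c₃ * ‖B‖ ^ 3) := by rw [hsB, mul_pow]; field_simp

/-- **First-order variation of the unscaled-field law** (lens Sketch14 `firstOrder_unscaled`):
`‖s⁻²𝒲(sB) + 𝒪(sB) − 𝒪(0)‖ ≤ s(c₃‖B‖³ + c₁‖B‖)` for EVERY `s > 0`, from `‖𝒲(A)‖ ≤ c₃‖A‖³` and `‖𝒪(A) − 𝒪(0)‖ ≤ c₁‖A‖`.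
[cite: Balaban1987RG1, (2.10)–(2.13) pp.267–268] -/
theorem firstOrder_unscaled {𝒲 𝒪 : (Λ → ℝ) → ℂ} {c₃ c₁ s : ℝ} (hs : 0 < s)
    (h𝒲 : ∀ A, ‖𝒲 A‖ ≤ c₃ * ‖A‖ ^ 3) (h𝒪 : ∀ A, ‖𝒪 A - 𝒪 0‖ ≤ c₁ * ‖A‖) (B : Λ → ℝ) :
    ‖((s : ℂ) ^ 2)⁻¹ * 𝒲 (s • B) + 𝒪 (s • B) - 𝒪 0‖ ≤ s * (c₃ * ‖B‖ ^ 3 + c₁ * ‖B‖) := by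
  have hsB : ‖s • B‖ = s * ‖B‖ := by rw [norm_smul, Real.norm_eq_abs, abs_of_pos hs]
  have h2 : ‖𝒪 (s • B) - 𝒪 0‖ ≤ s * (c₁ * ‖B‖) := by
    calc ‖𝒪 (s • B) - 𝒪 0‖ ≤ c₁ * ‖s • B‖ := h𝒪 _
      _ = s * (c₁ * ‖B‖) := by rw [hsB]; ring
  rw [add_sub_assoc, mul_add]
  exact (norm_add_le _ _).trans (add_le_add (norm_scaledW_le hs h𝒲 B) h2)

/-- **Second-order variation of the unscaled-field law** (lens Sketch14 `secondOrder_unscaled`): with the cubic part `𝒲₃`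
(`𝒲₃(rA) = r³𝒲₃(A)`, `‖𝒲 − 𝒲₃‖ ≤ c₄‖A‖⁴`) and the differential `D𝒪` of the older terms at zero field (`D𝒪(rA) = rD𝒪(A)`,
`‖𝒪(A) − 𝒪(0) − D𝒪(A)‖ ≤ c₂‖A‖²`): `‖s⁻²𝒲(sB) + 𝒪(sB) − 𝒪(0) − s(𝒲₃(B) + D𝒪(B))‖ ≤ s²(c₄‖B‖⁴ + c₂‖B‖²)` for EVERY `s > 0`
— the odd part is `𝐕₁ = s(𝒲₃ + D𝒪)`. [cite: Balaban1987RG1, (2.10)–(2.13) pp.267–268] -/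
theorem secondOrder_unscaled {𝒲 𝒲₃ 𝒪 D𝒪 : (Λ → ℝ) → ℂ} {c₄ c₂ s : ℝ} (hs : 0 < s)
    (h𝒲 : ∀ A, ‖𝒲 A - 𝒲₃ A‖ ≤ c₄ * ‖A‖ ^ 4) (h𝒲₃ : ∀ (r : ℝ) A, 𝒲₃ (r • A) = (r : ℂ) ^ 3 * 𝒲₃ A)
    (h𝒪 : ∀ A, ‖𝒪 A - 𝒪 0 - D𝒪 A‖ ≤ c₂ * ‖A‖ ^ 2) (hD𝒪 : ∀ (r : ℝ) A, D𝒪 (r • A) = (r : ℂ) * D𝒪 A)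
    (B : Λ → ℝ) :
    ‖((s : ℂ) ^ 2)⁻¹ * 𝒲 (s • B) + 𝒪 (s • B) - 𝒪 0 - (s : ℂ) * (𝒲₃ B + D𝒪 B)‖
      ≤ s ^ 2 * (c₄ * ‖B‖ ^ 4 + c₂ * ‖B‖ ^ 2) := by
  have hs0 : (s : ℂ) ≠ 0 := by exact_mod_cast hs.ne'
  have hsB : ‖s • B‖ = s * ‖B‖ := by rw [norm_smul, Real.norm_eq_abs, abs_of_pos hs]
  have e : ((s : ℂ) ^ 2)⁻¹ * 𝒲 (s • B) + 𝒪 (s • B) - 𝒪 0 - (s : ℂ) * (𝒲₃ B + D𝒪 B)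
      = ((s : ℂ) ^ 2)⁻¹ * (𝒲 (s • B) - 𝒲₃ (s • B)) + (𝒪 (s • B) - 𝒪 0 - D𝒪 (s • B)) := by
    rw [h𝒲₃ s B, hD𝒪 s B]; field_simp; ring
  rw [e]
  have h1 : ‖((s : ℂ) ^ 2)⁻¹ * (𝒲 (s • B) - 𝒲₃ (s • B))‖ ≤ s ^ 2 * (c₄ * ‖B‖ ^ 4) := by
    rw [norm_mul, norm_inv, norm_pow, Complex.norm_real, Real.norm_eq_abs, abs_of_pos hs]
    calc (s ^ 2)⁻¹ * ‖𝒲 (s • B) - 𝒲₃ (s • B)‖ ≤ (s ^ 2)⁻¹ * (c₄ * ‖s • B‖ ^ 4) :=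
          mul_le_mul_of_nonneg_left (h𝒲 _) (by positivity)
      _ = s ^ 2 * (c₄ * ‖B‖ ^ 4) := by rw [hsB, mul_pow]; field_simp
  have h2 : ‖𝒪 (s • B) - 𝒪 0 - D𝒪 (s • B)‖ ≤ s ^ 2 * (c₂ * ‖B‖ ^ 2) := by
    calc ‖𝒪 (s • B) - 𝒪 0 - D𝒪 (s • B)‖ ≤ c₂ * ‖s • B‖ ^ 2 := h𝒪 _
      _ = s ^ 2 * (c₂ * ‖B‖ ^ 2) := by rw [hsB, mul_pow]; ring
  rw [mul_add]
  exact (norm_add_le _ _).trans (add_le_add h1 h2)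

omit [Fintype Λ] in
/-- A function homogeneous of ODD degree under real dilations is odd (lens Sketch14 `odd_of_homogeneous`): `f(rA) = rⁿf(A)`,
`n` odd ⇒ `f(−A) = −f(A)` — so the odd part `𝐕₁ = s(𝒲₃ + D𝒪)` of the unscaled-field law IS odd, as the parity mechanism of
`B13Term214Centred` (`centredLinearPart_odd`) requires ([I] p. 267: the cubic vertex and the first derivative of the older
terms). [cite: Balaban1987RG1, (2.10)–(2.13) pp.267–268] (elementary) -/
theorem odd_of_homogeneous {f : (Λ → ℝ) → ℂ} {n : ℕ} (hn : Odd n)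
    (hf : ∀ (r : ℝ) A, f (r • A) = (r : ℂ) ^ n * f A) (A : Λ → ℝ) : f (-A) = -f A := by
  have h := hf (-1) A
  rw [neg_one_smul] at h
  rw [h, Complex.ofReal_neg, Complex.ofReal_one, hn.neg_one_pow]
  ring

/-- **The (2.20) letter is `s`-uniform ON THE BOX only** (lens Sketch14 `h220_unscaled_onBox`): `‖s⁻²𝒲(sB)‖ ≤ c₃ε·B·B`
when `s‖B‖ ≤ ε` — print's restriction «g_k|B| < ε₁» ([II] (1.20), [I] (2.9)); off the box a cubic majorant gives no
`s`-uniform quadratic bound, so the datum either reads `𝒲` through the box projection or the engines take their (2.20)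
letters on the support of `χ`. [cite: Balaban1988RG2Cluster, (1.20) p.6, (2.20) p.16; Balaban1987RG1, (2.9) p.266] -/
theorem h220_unscaled_onBox {𝒲 : (Λ → ℝ) → ℂ} {c₃ s ε : ℝ} (hs : 0 < s) (hc₃ : 0 ≤ c₃)
    (h𝒲 : ∀ A, ‖𝒲 A‖ ≤ c₃ * ‖A‖ ^ 3) (B : Λ → ℝ) (hbox : s * ‖B‖ ≤ ε) :
    ‖((s : ℂ) ^ 2)⁻¹ * 𝒲 (s • B)‖ ≤ c₃ * ε * (B ⬝ᵥ B) := by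
  have hε : 0 ≤ ε := le_trans (mul_nonneg hs.le (norm_nonneg _)) hbox
  calc ‖((s : ℂ) ^ 2)⁻¹ * 𝒲 (s • B)‖ ≤ s * (c₃ * ‖B‖ ^ 3) := norm_scaledW_le hs h𝒲 B
    _ = c₃ * (s * ‖B‖) * ‖B‖ ^ 2 := by ring
    _ ≤ c₃ * ε * ‖B‖ ^ 2 := mul_le_mul_of_nonneg_right (mul_le_mul_of_nonneg_left hbox hc₃) (sq_nonneg _)
    _ ≤ c₃ * ε * (B ⬝ᵥ B) := mul_le_mul_of_nonneg_left (pi_norm_sq_le_dotProduct B) (mul_nonneg hc₃ hε)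

/-- **The first-order variation in exponential-letter form, `s`-FREE constant, any rate `δ > 0`** (lens Sketch14
`firstOrder_unscaled_gauss`): `‖s⁻²𝒲(sB) + 𝒪(sB) − 𝒪(0)‖ ≤ s·[(c₃(3/(eδ))³ + c₁/(eδ))e^{δ/2}]·e^{½δ B·B}`.
[cite: Balaban1987RG1, (2.10)–(2.13) pp.267–268; Balaban1988RG2Cluster, (2.20) p.16] -/
theorem firstOrder_unscaled_gauss {𝒲 𝒪 : (Λ → ℝ) → ℂ} {c₃ c₁ s δ : ℝ} (hs : 0 < s) (hδ : 0 < δ)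
    (hc₃ : 0 ≤ c₃) (hc₁ : 0 ≤ c₁)
    (h𝒲 : ∀ A, ‖𝒲 A‖ ≤ c₃ * ‖A‖ ^ 3) (h𝒪 : ∀ A, ‖𝒪 A - 𝒪 0‖ ≤ c₁ * ‖A‖) (B : Λ → ℝ) :
    ‖((s : ℂ) ^ 2)⁻¹ * 𝒲 (s • B) + 𝒪 (s • B) - 𝒪 0‖
      ≤ s * (((c₃ * (3 / (Real.exp 1 * δ)) ^ 3 + c₁ * (1 / (Real.exp 1 * δ))) * Real.exp (δ / 2))
          * Real.exp (δ / 2 * (B ⬝ᵥ B))) := by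
  refine (firstOrder_unscaled hs h𝒲 h𝒪 B).trans (mul_le_mul_of_nonneg_left ?_ hs.le)
  have h3 : ‖B‖ ^ 3 ≤ (3 / (Real.exp 1 * δ)) ^ 3 * Real.exp (δ / 2) * Real.exp (δ / 2 * (B ⬝ᵥ B)) := by
    simpa using norm_pow_le_gauss B hδ (k := 3) (by norm_num)
  have h1 : ‖B‖ ≤ (1 / (Real.exp 1 * δ)) * Real.exp (δ / 2) * Real.exp (δ / 2 * (B ⬝ᵥ B)) := by
    simpa using norm_pow_le_gauss B hδ (k := 1) (by norm_num)
  calc c₃ * ‖B‖ ^ 3 + c₁ * ‖B‖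
      ≤ c₃ * ((3 / (Real.exp 1 * δ)) ^ 3 * Real.exp (δ / 2) * Real.exp (δ / 2 * (B ⬝ᵥ B)))
          + c₁ * ((1 / (Real.exp 1 * δ)) * Real.exp (δ / 2) * Real.exp (δ / 2 * (B ⬝ᵥ B))) :=
        add_le_add (mul_le_mul_of_nonneg_left h3 hc₃) (mul_le_mul_of_nonneg_left h1 hc₁)
    _ = _ := by ring

/-- **The second-order variation in exponential-letter form, `s`-FREE constant, any rate `δ > 0`** (lens Sketch14
`secondOrder_unscaled_gauss`): `≤ s²·[(c₄(4/(eδ))⁴ + c₂(2/(eδ))²)e^{δ/2}]·e^{½δ B·B}`.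
[cite: Balaban1987RG1, (2.10)–(2.13) pp.267–268; Balaban1988RG2Cluster, (2.20) p.16] -/
theorem secondOrder_unscaled_gauss {𝒲 𝒲₃ 𝒪 D𝒪 : (Λ → ℝ) → ℂ} {c₄ c₂ s δ : ℝ} (hs : 0 < s) (hδ : 0 < δ)
    (hc₄ : 0 ≤ c₄) (hc₂ : 0 ≤ c₂)
    (h𝒲 : ∀ A, ‖𝒲 A - 𝒲₃ A‖ ≤ c₄ * ‖A‖ ^ 4) (h𝒲₃ : ∀ (r : ℝ) A, 𝒲₃ (r • A) = (r : ℂ) ^ 3 * 𝒲₃ A)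
    (h𝒪 : ∀ A, ‖𝒪 A - 𝒪 0 - D𝒪 A‖ ≤ c₂ * ‖A‖ ^ 2) (hD𝒪 : ∀ (r : ℝ) A, D𝒪 (r • A) = (r : ℂ) * D𝒪 A)
    (B : Λ → ℝ) :
    ‖((s : ℂ) ^ 2)⁻¹ * 𝒲 (s • B) + 𝒪 (s • B) - 𝒪 0 - (s : ℂ) * (𝒲₃ B + D𝒪 B)‖
      ≤ s ^ 2 * (((c₄ * (4 / (Real.exp 1 * δ)) ^ 4 + c₂ * (2 / (Real.exp 1 * δ)) ^ 2) * Real.exp (δ / 2))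
          * Real.exp (δ / 2 * (B ⬝ᵥ B))) := by
  refine (secondOrder_unscaled hs h𝒲 h𝒲₃ h𝒪 hD𝒪 B).trans (mul_le_mul_of_nonneg_left ?_ (sq_nonneg _))
  have h4 : ‖B‖ ^ 4 ≤ (4 / (Real.exp 1 * δ)) ^ 4 * Real.exp (δ / 2) * Real.exp (δ / 2 * (B ⬝ᵥ B)) := by
    simpa using norm_pow_le_gauss B hδ (k := 4) (by norm_num)
  have h2 : ‖B‖ ^ 2 ≤ (2 / (Real.exp 1 * δ)) ^ 2 * Real.exp (δ / 2) * Real.exp (δ / 2 * (B ⬝ᵥ B)) := by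
    simpa using norm_pow_le_gauss B hδ (k := 2) (by norm_num)
  calc c₄ * ‖B‖ ^ 4 + c₂ * ‖B‖ ^ 2
      ≤ c₄ * ((4 / (Real.exp 1 * δ)) ^ 4 * Real.exp (δ / 2) * Real.exp (δ / 2 * (B ⬝ᵥ B)))
          + c₂ * ((2 / (Real.exp 1 * δ)) ^ 2 * Real.exp (δ / 2) * Real.exp (δ / 2 * (B ⬝ᵥ B))) :=
        add_le_add (mul_le_mul_of_nonneg_left h4 hc₄) (mul_le_mul_of_nonneg_left h2 hc₂)
    _ = _ := by ring

/-- **The first exponential Taylor letter `h1e` for the unscaled-field family, `s`-FREE constant** (lens Sketch14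
`h1e_of_unscaledLaw`): with `|τ(Y)| ≤ R` on `𝐃` and the homogeneous majorants uniform in `Y`,
`Σ_Y |τ(Y)|·‖s⁻²𝒲(Y,sB) + 𝒪(Y,sB) − 𝒪(Y,0)‖ ≤ s·[R·|𝐃|·(c₃(3/(eδ))³ + c₁/(eδ))e^{δ/2}]·e^{½δ B·B}` for EVERY `s > 0` — the
shape of `B13Bound226CentredRem.norm_core214_sub_le_K_centred_of_primitives_exp`'s `h1e`.
[cite: Balaban1987RG1, (2.10)–(2.13) pp.267–268; Balaban1988RG2Cluster, (2.14) p.15, (2.20) p.16] -/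
theorem h1e_of_unscaledLaw (Dfam : Finset D) (τ : D → ℂ) {R : ℝ} (hR : 0 ≤ R) (hτ : ∀ Y ∈ Dfam, ‖τ Y‖ ≤ R)
    {𝒲 𝒪 : D → (Λ → ℝ) → ℂ} {c₃ c₁ s δ : ℝ} (hs : 0 < s) (hδ : 0 < δ) (hc₃ : 0 ≤ c₃) (hc₁ : 0 ≤ c₁)
    (h𝒲 : ∀ Y A, ‖𝒲 Y A‖ ≤ c₃ * ‖A‖ ^ 3) (h𝒪 : ∀ Y A, ‖𝒪 Y A - 𝒪 Y 0‖ ≤ c₁ * ‖A‖) (B : Λ → ℝ) :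
    ∑ Y ∈ Dfam, ‖τ Y‖ * ‖((s : ℂ) ^ 2)⁻¹ * 𝒲 Y (s • B) + 𝒪 Y (s • B) - 𝒪 Y 0‖
      ≤ s * ((R * Dfam.card * ((c₃ * (3 / (Real.exp 1 * δ)) ^ 3 + c₁ * (1 / (Real.exp 1 * δ))) * Real.exp (δ / 2)))
          * Real.exp (δ / 2 * (B ⬝ᵥ B))) := by
  set K : ℝ := (c₃ * (3 / (Real.exp 1 * δ)) ^ 3 + c₁ * (1 / (Real.exp 1 * δ))) * Real.exp (δ / 2) with hK
  have hE : ∀ Y ∈ Dfam, ‖τ Y‖ * ‖((s : ℂ) ^ 2)⁻¹ * 𝒲 Y (s • B) + 𝒪 Y (s • B) - 𝒪 Y 0‖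
      ≤ R * (s * (K * Real.exp (δ / 2 * (B ⬝ᵥ B)))) := fun Y hY =>
    mul_le_mul (hτ Y hY) (firstOrder_unscaled_gauss hs hδ hc₃ hc₁ (h𝒲 Y) (h𝒪 Y) B) (norm_nonneg _) hR
  calc ∑ Y ∈ Dfam, ‖τ Y‖ * ‖((s : ℂ) ^ 2)⁻¹ * 𝒲 Y (s • B) + 𝒪 Y (s • B) - 𝒪 Y 0‖
      ≤ ∑ Y ∈ Dfam, R * (s * (K * Real.exp (δ / 2 * (B ⬝ᵥ B)))) := Finset.sum_le_sum hE
    _ = _ := by rw [Finset.sum_const, nsmul_eq_mul]; ring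

/-- **The second exponential Taylor letter `h2e` for the unscaled-field family, `s`-FREE constant** (lens Sketch14
`h2e_of_unscaledLaw`), with the odd part `𝐕₁(Y,B) = s(𝒲₃(Y,B) + D𝒪(Y,B))`:
`Σ_Y |τ(Y)|·‖𝐕_s − 𝐕₀ − 𝐕₁‖ ≤ s²·[R·|𝐃|·(c₄(4/(eδ))⁴ + c₂(2/(eδ))²)e^{δ/2}]·e^{½δ B·B}` for EVERY `s > 0`.
[cite: Balaban1987RG1, (2.10)–(2.13) pp.267–268; Balaban1988RG2Cluster, (2.14) p.15, (2.20) p.16] -/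
theorem h2e_of_unscaledLaw (Dfam : Finset D) (τ : D → ℂ) {R : ℝ} (hR : 0 ≤ R) (hτ : ∀ Y ∈ Dfam, ‖τ Y‖ ≤ R)
    {𝒲 𝒲₃ 𝒪 D𝒪 : D → (Λ → ℝ) → ℂ} {c₄ c₂ s δ : ℝ} (hs : 0 < s) (hδ : 0 < δ) (hc₄ : 0 ≤ c₄) (hc₂ : 0 ≤ c₂)
    (h𝒲 : ∀ Y A, ‖𝒲 Y A - 𝒲₃ Y A‖ ≤ c₄ * ‖A‖ ^ 4) (h𝒲₃ : ∀ Y (r : ℝ) A, 𝒲₃ Y (r • A) = (r : ℂ) ^ 3 * 𝒲₃ Y A)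
    (h𝒪 : ∀ Y A, ‖𝒪 Y A - 𝒪 Y 0 - D𝒪 Y A‖ ≤ c₂ * ‖A‖ ^ 2) (hD𝒪 : ∀ Y (r : ℝ) A, D𝒪 Y (r • A) = (r : ℂ) * D𝒪 Y A)
    (B : Λ → ℝ) :
    ∑ Y ∈ Dfam, ‖τ Y‖ * ‖((s : ℂ) ^ 2)⁻¹ * 𝒲 Y (s • B) + 𝒪 Y (s • B) - 𝒪 Y 0 - (s : ℂ) * (𝒲₃ Y B + D𝒪 Y B)‖
      ≤ s ^ 2 * ((R * Dfam.card * ((c₄ * (4 / (Real.exp 1 * δ)) ^ 4 + c₂ * (2 / (Real.exp 1 * δ)) ^ 2)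
          * Real.exp (δ / 2))) * Real.exp (δ / 2 * (B ⬝ᵥ B))) := by
  set K : ℝ := (c₄ * (4 / (Real.exp 1 * δ)) ^ 4 + c₂ * (2 / (Real.exp 1 * δ)) ^ 2) * Real.exp (δ / 2) with hK
  have hE : ∀ Y ∈ Dfam,
      ‖τ Y‖ * ‖((s : ℂ) ^ 2)⁻¹ * 𝒲 Y (s • B) + 𝒪 Y (s • B) - 𝒪 Y 0 - (s : ℂ) * (𝒲₃ Y B + D𝒪 Y B)‖
        ≤ R * (s ^ 2 * (K * Real.exp (δ / 2 * (B ⬝ᵥ B)))) := fun Y hY =>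
    mul_le_mul (hτ Y hY) (secondOrder_unscaled_gauss hs hδ hc₄ hc₂ (h𝒲 Y) (h𝒲₃ Y) (h𝒪 Y) (hD𝒪 Y) B)
      (norm_nonneg _) hR
  calc ∑ Y ∈ Dfam, ‖τ Y‖ * ‖((s : ℂ) ^ 2)⁻¹ * 𝒲 Y (s • B) + 𝒪 Y (s • B) - 𝒪 Y 0 - (s : ℂ) * (𝒲₃ Y B + D𝒪 Y B)‖
      ≤ ∑ Y ∈ Dfam, R * (s ^ 2 * (K * Real.exp (δ / 2 * (B ⬝ᵥ B)))) := Finset.sum_le_sum hE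
    _ = _ := by rw [Finset.sum_const, nsmul_eq_mul]; ring

end Literature.MathematicalPhysics.QuantumFieldTheory.Balaban1983to89.B13CentredExpLetters

end
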